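import Summits.BirchSwinnertonDyer.Rank1Residual.X11b.BDPRouteEndState
import Summits.BirchSwinnertonDyer.BirchSwinnertonDyer.Theses.ErratumRoadFive
import HarnessLib

/-!
# Route `ErratumRoadFive`, crux `ShimuraDisplays` (item stmt-BirchSwinnertonDyer-19063) — PART 2:
# the rung-K2a glue with crux 3 RESTATED to what the kernel consumes

Cell `bsd-stepL` (run/shared/lean/pub/bsd-stepL/), seat `bsd-stepL-shim-p1` (prover g0),
`--supports stmt-BirchSwinnertonDyer-19063`.

## What this file does

The deciding theorem `Summit.BirchSwinnertonDyer.BirchSwinnertonDyer.Theses.ErratumRoadFive.closes`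
binds the five cruxes `OpenInputIMC`, `EulerHalfOffLocus`, `ShimuraDisplays`, `X11aLowerHalf`,
`NonSurjCorner` and the support conjunction `PublishedInputsFive`, and re-plumbs the kernel glue
`X11b.multiplicativeRankOne_of_endState` (`X11b/RungK2Leaves.lean` §2 = `P2.bsdp_of_onTree_endState`).
That kernel consumes crux 3, `ShimuraDisplays = ∀ (E,p) ∈ X11b, p ≥ 5 → P2ShimuraDisplaysAt W p`, at ONE
place only: the Euler-system half `Typed.MissingUpperBoundAt W p` on the Tamagawa sub-atom
(ram) ∧ ¬(split at `p` ∧ `p ∣ ord_p Δ_min`) (`missingUpperBoundAt_of_classX11b_of_ram_of_not_alpha_displays`,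
`X11b/BDPRouteRecordDelta.lean`). This file proves the glue with crux 3 REPLACED by exactly that
consumer-shaped statement,

  `ShimuraUpperHalf := ∀ (E,p) ∈ X11b, p ≥ 5 → Ram → ¬(split at p ∧ p ∣ ord_p Δ_min) →
    Typed.MissingUpperBoundAt W p`,

atom by atom over the records of `X11b/BDPRouteEndState.lean` §2 — so that the planner may restate item
19063 to `ShimuraUpperHalf` (or fold it): the sibling PART 1
(`ErratumRoadFiveShimuraUpperHalf.lean`, `missingUpperBoundAt_of_classX11b_of_ram_of_not_alpha_pub`)
proves `ShimuraUpperHalf` from PUBLISHED packages (Pasten 2024 §6; Cai–Shu–Tian 2014 Thm. 1.5 + JSW 2017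
Thm. 4.4.1; Jacquet–Langlands; the route's published inputs), whereas `ShimuraDisplays` AS STATED asks
the Shimura display also at inert sets `S ∋ p`, outside the standing hypothesis (split) of
[JetchevSkinnerWan2017, §4] under which Thm. 4.4.1 is printed.

* `erratumRoadFive_multiplicativeRankOne_of_upperHalf` — `closes` with `h₃ : ShimuraDisplays` replaced by
  `h₃' : ShimuraUpperHalf` (displayed inline; no new definition).
* `erratumRoadFive_shimuraUpperHalf_of_shimuraDisplays` — the old crux implies the restated one
  (the kernel's own reduction), so nothing is lost by restating.

HONEST FRAMING: CONDITIONAL on every binder (the cruxes are OPEN); fact-free re-plumbing of kernel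
theorems; nothing is booked; BSD is not proved by any of this; the conclusion is the registered rung
leaf `X11b.MultiplicativeRankOne`, never the summit Statement.
-/

noncomputable section

open scoped Classical

open WeierstrassCurve NumberField IsDedekindDomain Literature.NumberTheory.EllipticCurves
  Literature.NumberTheory.EllipticCurves.ModularForms
  Literature.NumberTheory.EllipticCurves.Rank1Residual
  Literature.NumberTheory.EllipticCurves.Rank1Residual.Typed
  Literature.NumberTheory.EllipticCurves.Wuthrich2014
  Literature.NumberTheory.EllipticCurves.BalakrishnanEtAl2019
  Literature.NumberTheory.GaloisRepresentations Literature.NumberTheory.GaloisCohomology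
  Summit.BirchSwinnertonDyer.Rank1Residual
  Summit.BirchSwinnertonDyer.Rank1Residual.X11b
  Summit.BirchSwinnertonDyer.BirchSwinnertonDyer.Theses.ErratumRoadFive

-- the cell's Theorems namespace repeats the summit name (Summit.<Summit>.<Problem>), as in every sibling file
set_option linter.dupNamespace false

namespace Summit.BirchSwinnertonDyer.BirchSwinnertonDyer.Theorems

/-- **The kernel's own reduction: crux 3 as stated implies its consumer-shaped restatement.**
`ShimuraDisplays` (the Shimura displays `P2ShimuraDisplaysAt` at every X11b pair with `p ≥ 5`) gives the
Euler-system half on (ram) ∧ ¬(T2α) via `missingUpperBoundAt_of_classX11b_of_ram_of_not_alpha_displays`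
(cell `b2b-bsdres`, gen 12) and the published conjuncts of `PublishedInputsFive` (Skinner 2016 Thm. C,
GZK, modularity ×2, Friedberg–Hoffstein inert form, Mazur 1978 Cor. 4.1; the Néron mapping property is the
tree theorem `integral_neronScaling_of_isGloballyMinimal_holds`). [folklore] -/
theorem erratumRoadFive_shimuraUpperHalf_of_shimuraDisplays (h₃ : ShimuraDisplays)
    (h₆ : PublishedInputsFive) :
    ∀ (W : WeierstrassCurve ℚ) [W.IsElliptic] [W.IsGloballyMinimal] (p : ℕ) [Fact p.Prime],
      ClassX11b W p → 5 ≤ p → Ram W p →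
      ¬ (W.HasSplitMultiplicativeReductionAtPrime p ∧ p ∣ padicValInt p W.minimalDiscriminantInt) →
      Typed.MissingUpperBoundAt W p := by
  obtain ⟨-, -, -, hSk, -, hGZK, hmod, hnf, -, -, hMaz, -, hFH, -, -⟩ := h₆
  exact missingUpperBoundAt_of_classX11b_of_ram_of_not_alpha_displays hSk hGZK hmod hnf hFH hMaz
    integral_neronScaling_of_isGloballyMinimal_holds h₃

/-- **Rung K2a with crux 3 restated** — the deciding theorem `ErratumRoadFive.closes` with its binder
`h₃ : ShimuraDisplays` REPLACED by the consumer-shaped `h₃' : ∀ (E,p) ∈ X11b, p ≥ 5 → (ram) →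
¬(split at p ∧ p ∣ ord_p Δ_min) → Typed.MissingUpperBoundAt W p` (proved from published packages in
`ErratumRoadFiveShimuraUpperHalf.lean`). Proof atom by atom over the kernel records of
`X11b/BDPRouteEndState.lean` §2: ¬Surj → the localised corner (`ClassX11b.not_surj_shape`, BDMTV) is
crux 5; Surj ∧ `p ∤ ∏c` → the Locus record ((ram), `P2.bsdp_of_locus_endState`) or the ¬(ram) record with
crux 4 on the twist (`P2.bsdp_of_not_ram_endState`); Surj ∧ `p ∣ ∏c` →
`P2.bsdp_of_surj_of_missingUpperBoundAt_endState` with the upper half from crux 2 (¬(ram) or (T2α)) or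
from `h₃'` ((ram) ∧ ¬(T2α)). CONDITIONAL on every binder; nothing booked; concludes the registered rung
leaf, not the summit. [cite: JetchevSkinnerWan2017, §7.4.1–7.4.3 (pp. 30–31), Thm. 4.4.1 (p. 19)]
[cite: Castella2018, Thm. 2.3, Thm. 3.2] [cite: Castella2018Erratum, (2.4)] [cite: BalakrishnanEtAl2019, Thm. 1.2] -/
theorem erratumRoadFive_multiplicativeRankOne_of_upperHalf
    (h₁ : OpenInputIMC) (h₂ : EulerHalfOffLocus)
    (h₃' : ∀ (W : WeierstrassCurve ℚ) [W.IsElliptic] [W.IsGloballyMinimal] (p : ℕ) [Fact p.Prime],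
      ClassX11b W p → 5 ≤ p → Ram W p →
      ¬ (W.HasSplitMultiplicativeReductionAtPrime p ∧ p ∣ padicValInt p W.minimalDiscriminantInt) →
      Typed.MissingUpperBoundAt W p)
    (h₄ : X11aLowerHalf) (h₅ : NonSurjCorner) (h₆ : PublishedInputsFive) :
    Summit.BirchSwinnertonDyer.Rank1Residual.X11b.MultiplicativeRankOne := by
  obtain ⟨hGZ, hKo, hB, hSk, hWu, hGZK, hmod, hnf, hHL, hFHs, hMaz, hBDMTV, hFH, hPT, hEP⟩ := h₆
  intro W _ _ p _ hX hp5
  have hA : P2OpenInputOnTreeAt W p := h₁ W p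
  by_cases hsurj : Surj W p
  · by_cases htam : p ∣ W.tamagawaProduct
    · -- `p ∣ ∏c`: the Euler-system half is crux 2 off (ram) ∧ ¬(T2α), and `h₃'` on it
      have hU : Typed.MissingUpperBoundAt W p := by
        by_cases hram : Ram W p
        · by_cases hα : W.HasSplitMultiplicativeReductionAtPrime p ∧
              p ∣ padicValInt p W.minimalDiscriminantInt
          · exact h₂ W p hX hp5 htam (Or.inr hα)
          · exact h₃' W p hX hp5 hram hα
        · exact h₂ W p hX hp5 htam (Or.inl hram)
      exact P2.bsdp_of_surj_of_missingUpperBoundAt_endState W p hGZ hKo hWu hGZK hmod hnf hHL hMaz hPT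
        hEP hA hU hX hp5 hsurj
    · by_cases hram : Ram W p
      · exact P2.bsdp_of_locus_endState W p hGZ hKo hB hSk hWu hGZK hmod hnf hHL hMaz hPT hEP hA hX
          hp5 hram htam
      · exact P2.bsdp_of_not_ram_endState W p hGZ hKo hB hWu hGZK hmod hnf hHL hFHs hMaz hPT hEP hA
          (fun Wd _ _ hXd ↦ h₄ Wd p hXd) hX hp5 hram hsurj htam
  · -- the non-surjective corner: `p ∈ {5,7}`, `p ∣ ord_p Δ_min`, no (ram) prime (BDMTV)
    obtain ⟨h57, hdvd, hnram⟩ := ClassX11b.not_surj_shape W p hBDMTV hX hp5 hsurj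
    exact Typed.bsdp_of_missingPPartAt W p hGZK (by rw [hX.1]) (h₅ W p hX hsurj h57 hdvd hnram)

end Summit.BirchSwinnertonDyer.BirchSwinnertonDyer.Theorems

end
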